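import Literature.NumberTheory.Automorphic.UnitaryGroupCotangentSpectralProjectionConj
import Literature.NumberTheory.Rogawski1990.CohomologicalSpectrumInnerForm
import Literature.NumberTheory.Automorphic.HarishChandraGLConj
import HarnessLib

/-!
# The conjugate `σ̄` of an abstract representation and the HOLOMORPHIC ⟺ ANTIHOLOMORPHIC symmetry of the cohomological-spectrum
# letters (E1′) `cohFinComponentUnique_*` and (E) `cohIsotypicLine_*`

Topic `NumberTheory/Automorphic`; namespaces `Representation` (one generic transport lemma, as in ★ `IrreducibleTwistTransport`),
`Literature.NumberTheory.Automorphic.ConjVec` (the conjugate `repConj σ` of a group representation on the conjugate complex structure ★ `ConjVec`,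
★ `HarishChandraGLConj`), `Literature.NumberTheory.Automorphic.UnitaryGroup.CotangentForms` (the junction with ★ `UnitaryGroupCohomologicalForms`,
★ `UnitaryGroupCotangentSpectralProjection`, ★ `Rogawski1990/CohomologicalSpectrumInnerForm`).  Definitions with bodies (`repConj`, `conjMap`,
`unconjMap`) and theorems; no named fact, no instance, no `sorry`.

WHY.  The floor-0 engine letters of the Hodge-CM cell come in `(1,0)`∕`(0,1)` PAIRS: (E1′) `cohFinComponentUnique_hol` ∕ `_antihol` and (E)
`cohIsotypicLine_hol` ∕ `_antihol` (consumed by the crux-`H413` folds of programmes P3 (S3∕S4) and P2a).  Complex conjugation identifies the two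
members of each pair: `Φ ↦ Φ̄` (★ `conjFun`, conjugate-linear, commuting with right translation) exchanges `holCotForms` and its `conjFun`-image, `P ↦ P̄`
(★ `DiscreteAutomorphicRep.conj`) exchanges Hodge types (★ `isAntiholCotangentAt_iff_conj`), and an abstract `σ` on `W` is replaced by its CONJUGATE
`σ̄ = repConj σ` on `W̄ = ConjVec W` (same operators, scalars acting through `c ↦ c̄`): `σ̄` is irreducible ∕ smooth iff `σ` is, `P̄` has finite
component `σ̄` iff `P` has finite component `σ`, and `ψ ↦ ψ̄ := conjFun ∘ ψ ∘ toConj⁻¹` is a bijection between the `σ`-equivariant maps into the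
antiholomorphic forms contained in `P` and the `σ̄`-equivariant maps into the holomorphic forms contained in `P̄`, semilinear in the scalar.  Hence
**(E1′-hol) ⟺ (E1′-antihol)** and **(E-hol) ⟺ (E-antihol)**: four sockets are two ([BorelWallach2000, VII 2.10]: conjugation exchanges the
`(p,q)` and `(q,p)` summands; [Clozel1990, §3.1]: the conjugate `^cπ` of an automorphic representation).

## References
* [BorelWallach2000] A. Borel, N. Wallach, *Continuous cohomology, discrete subgroups, and representations of reductive groups*, 2nd ed. (2000), VII 2.10, 3.2.
* [BorelJacquet1979] A. Borel, H. Jacquet, Corvallis PSPM 33.1 (1979), §4.6.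
* [Clozel1990] L. Clozel, *Motifs et formes automorphes*, in: Automorphic forms, Shimura varieties, and L-functions I (1990), §3.1.
* [Bump1997] D. Bump, *Automorphic forms and representations* (1997), §4.2 (twisting; irreducibility under equivalences).
-/

noncomputable section

open scoped InnerProductSpace
open MeasureTheory NumberField

/-! ## §1 Irreducibility is invariant under SEMILINEAR equivariant equivalences -/

namespace Representation

variable {k G V V' : Type*} [Field k] [Monoid G] [AddCommGroup V] [Module k V] [AddCommGroup V'] [Module k V']
  {τ τ' : k →+* k} [RingHomInvPair τ τ'] [RingHomInvPair τ' τ]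

/-- **Irreducibility is invariant under a `τ`-SEMILINEAR equivariant equivalence** `e : V ≃ₛₗ[τ] V'` (`e (ρ g v) = ρ' g (e v)`): `W ↦ e(W)` is
an order isomorphism of the lattices of stable subspaces (the semilinear form of ★ `isIrreducible_iff_of_equivariant`; e.g. complex conjugation).
[cite: Bump1997, §4.2 (twisting a representation by a character)] -/
theorem isIrreducible_iff_of_semilinearEquivariant (ρ : Representation k G V) (ρ' : Representation k G V')
    (e : V ≃ₛₗ[τ] V') (he : ∀ g v, e (ρ g v) = ρ' g (e v)) : ρ.IsIrreducible ↔ ρ'.IsIrreducible := by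
  have hfwd : ∀ (W : Subrepresentation ρ) (g : G) ⦃v' : V'⦄,
      v' ∈ W.toSubmodule.map (e : V →ₛₗ[τ] V') → ρ' g v' ∈ W.toSubmodule.map (e : V →ₛₗ[τ] V') := by
    intro W g v' hv'
    obtain ⟨v, hv, rfl⟩ := Submodule.mem_map.mp hv'
    exact Submodule.mem_map.mpr ⟨ρ g v, W.apply_mem_toSubmodule g hv, he g v⟩
  have hbwd : ∀ (W' : Subrepresentation ρ') (g : G) ⦃v : V⦄,
      v ∈ W'.toSubmodule.comap (e : V →ₛₗ[τ] V') → ρ g v ∈ W'.toSubmodule.comap (e : V →ₛₗ[τ] V') := by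
    intro W' g v hv
    simp only [Submodule.mem_comap, LinearEquiv.coe_coe] at hv ⊢
    rw [he g v]
    exact W'.apply_mem_toSubmodule g hv
  let Φ : Subrepresentation ρ ≃o Subrepresentation ρ' :=
    { toFun := fun W => ⟨W.toSubmodule.map (e : V →ₛₗ[τ] V'), hfwd W⟩
      invFun := fun W' => ⟨W'.toSubmodule.comap (e : V →ₛₗ[τ] V'), hbwd W'⟩
      left_inv := fun W => Subrepresentation.toSubmodule_injective
        (Submodule.comap_map_eq_of_injective e.injective _)
      right_inv := fun W' => Subrepresentation.toSubmodule_injective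
        (Submodule.map_comap_eq_of_surjective e.surjective _)
      map_rel_iff' := fun {W₁ W₂} => by
        change Submodule.map (e : V →ₛₗ[τ] V') W₁.toSubmodule ≤ Submodule.map (e : V →ₛₗ[τ] V') W₂.toSubmodule ↔
          W₁.toSubmodule ≤ W₂.toSubmodule
        exact Submodule.map_le_map_iff_of_injective e.injective _ _ }
  exact Φ.isSimpleOrder_iff

end Representation

/-! ## §2 The conjugate representation `σ̄ = repConj σ` on `W̄ = ConjVec W` -/

namespace Literature.NumberTheory.Automorphic

namespace ConjVec

variable {G : Type*} [Group G] {W : Type*} [AddCommGroup W] [Module ℂ W]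

/-- **The conjugate `σ̄` of a representation `σ` of a group on a complex vector space `W`**: the SAME operators on the conjugate complex structure
`W̄ = ConjVec W` (`c ·̄ w = c̄ · w`), `σ̄ g = toConj ∘ σ g ∘ toConj⁻¹` — complex-linear for the conjugate structure (★ `semilinearConjAlgHom`).  For an
automorphic `π = {φ}` this is the representation on `{φ̄}`. [cite: Clozel1990, §3.1] -/
def repConj (σ : Representation ℂ G W) : Representation ℂ G (ConjVec W) :=
  MonoidHom.comp (semilinearConjAlgHom (toConj (V := W)) : Module.End ℂ W →* Module.End ℂ (ConjVec W)) σ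

/-- Unfolding: `σ̄ g w = toConj (σ g (toConj⁻¹ w))`. [cite: Clozel1990, §3.1] -/
@[simp] theorem repConj_apply (σ : Representation ℂ G W) (g : G) (w : ConjVec W) :
    repConj σ g w = toConj (σ g ((toConj (V := W)).symm w)) := rfl

/-- `σ̄ g (toConj w) = toConj (σ g w)`. [cite: Clozel1990, §3.1] -/
theorem repConj_apply_toConj (σ : Representation ℂ G W) (g : G) (w : W) : repConj σ g (toConj w) = toConj (σ g w) := rfl

/-- **`σ̄` is irreducible iff `σ` is** (§1 along `toConj`). [cite: Bump1997, §4.2 (twisting a representation by a character)] -/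
theorem isIrreducible_repConj_iff (σ : Representation ℂ G W) : (repConj σ).IsIrreducible ↔ σ.IsIrreducible :=
  (Representation.isIrreducible_iff_of_semilinearEquivariant σ (repConj σ) (toConj (V := W)) fun _ _ => rfl).symm

/-- The stabiliser of `toConj w` under `σ̄` is the stabiliser of `w` under `σ`. [cite: Clozel1990, §3.1] -/
theorem stabilizerSubgroup_repConj (σ : Representation ℂ G W) (w : W) :
    (repConj σ).stabilizerSubgroup (toConj w) = σ.stabilizerSubgroup w := by
  ext g
  simp only [Representation.mem_stabilizerSubgroup, repConj_apply_toConj]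
  exact (toConj (V := W)).injective.eq_iff

/-- **`σ̄` is smooth iff `σ` is** (same stabilisers). [cite: Clozel1990, §3.1] -/
theorem isSmooth_repConj_iff [TopologicalSpace G] (σ : Representation ℂ G W) : (repConj σ).IsSmooth ↔ σ.IsSmooth := by
  constructor
  · intro h w
    have h' := h (toConj w)
    rw [Representation.isSmoothVector_iff, stabilizerSubgroup_repConj] at h'
    exact h'
  · intro h w
    have h' := h ((toConj (V := W)).symm w)
    rw [Representation.isSmoothVector_iff, ← stabilizerSubgroup_repConj, LinearEquiv.apply_symm_apply] at h'
    exact h'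

end ConjVec

/-! ## §3 Conjugating maps into the `ℂ²`-valued functions on `U(J)(𝔸_F)`, finite components, and the letters -/

namespace UnitaryGroup.CotangentForms

open ConjVec
open Literature.Geometry.ComplexHyperbolic.BallModel (U21)

section Maps

variable {F E : Type} [Field F] [NumberField F] [Field E] [NumberField E] [Algebra F E]
  {c : E ≃ₐ[F] E} {N : ℕ} {J : Matrix (Fin N) (Fin N) E}
  {W : Type} [AddCommGroup W] [Module ℂ W]

/-- **`ψ̄ := conjFun ∘ ψ ∘ toConj⁻¹`** — the COMPLEX-LINEAR map out of the conjugate space `W̄` attached to a complex-linear `ψ : W → (U(J)(𝔸_F) → ℂ²)`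
(conjugate-linear ∘ linear ∘ conjugate-linear). [cite: BorelWallach2000, VII 2.10] -/
def conjMap (ψ : W →ₗ[ℂ] ((adelicGroupData F E c N J).Adelic → (Fin 2 → ℂ))) :
    ConjVec W →ₗ[ℂ] ((adelicGroupData F E c N J).Adelic → (Fin 2 → ℂ)) :=
  (conjFun F E c N J).comp (ψ.comp ((toConj (V := W)).symm : ConjVec W →ₛₗ[starRingEnd ℂ] W))

/-- **`ψ := conjFun ∘ ψ' ∘ toConj`** — the inverse assignment, from maps out of `W̄` to maps out of `W`. [cite: BorelWallach2000, VII 2.10] -/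
def unconjMap (ψ' : ConjVec W →ₗ[ℂ] ((adelicGroupData F E c N J).Adelic → (Fin 2 → ℂ))) :
    W →ₗ[ℂ] ((adelicGroupData F E c N J).Adelic → (Fin 2 → ℂ)) :=
  (conjFun F E c N J).comp (ψ'.comp ((toConj (V := W)) : W →ₛₗ[starRingEnd ℂ] ConjVec W))

/-- Unfolding of `conjMap`. [cite: BorelWallach2000, VII 2.10] -/
@[simp] theorem conjMap_apply (ψ : W →ₗ[ℂ] ((adelicGroupData F E c N J).Adelic → (Fin 2 → ℂ))) (w : ConjVec W) :
    conjMap ψ w = conjFun F E c N J (ψ ((toConj (V := W)).symm w)) := rfl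

/-- Unfolding of `unconjMap`. [cite: BorelWallach2000, VII 2.10] -/
@[simp] theorem unconjMap_apply (ψ' : ConjVec W →ₗ[ℂ] ((adelicGroupData F E c N J).Adelic → (Fin 2 → ℂ))) (w : W) :
    unconjMap ψ' w = conjFun F E c N J (ψ' (toConj w)) := rfl

/-- `unconjMap (conjMap ψ) = ψ`. [cite: BorelWallach2000, VII 2.10] -/
theorem unconjMap_conjMap (ψ : W →ₗ[ℂ] ((adelicGroupData F E c N J).Adelic → (Fin 2 → ℂ))) : unconjMap (conjMap ψ) = ψ := by
  refine LinearMap.ext fun w => ?_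
  rw [unconjMap_apply, conjMap_apply, conjFun_conjFun]
  rfl

/-- `conjMap (unconjMap ψ') = ψ'`. [cite: BorelWallach2000, VII 2.10] -/
theorem conjMap_unconjMap (ψ' : ConjVec W →ₗ[ℂ] ((adelicGroupData F E c N J).Adelic → (Fin 2 → ℂ))) : conjMap (unconjMap ψ') = ψ' := by
  refine LinearMap.ext fun w => ?_
  rw [conjMap_apply, unconjMap_apply, conjFun_conjFun, LinearEquiv.apply_symm_apply]

/-- `unconjMap (r • ψ') = r̄ • unconjMap ψ'` (the assignment is conjugate-linear). [cite: BorelWallach2000, VII 2.10] -/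
theorem unconjMap_smul (r : ℂ) (ψ' : ConjVec W →ₗ[ℂ] ((adelicGroupData F E c N J).Adelic → (Fin 2 → ℂ))) :
    unconjMap (r • ψ') = starRingEnd ℂ r • unconjMap ψ' := by
  refine LinearMap.ext fun w => ?_
  rw [unconjMap_apply, LinearMap.smul_apply, LinearMap.map_smulₛₗ, LinearMap.smul_apply, unconjMap_apply]

/-- `conjMap (r • ψ) = r̄ • conjMap ψ`. [cite: BorelWallach2000, VII 2.10] -/
theorem conjMap_smul (r : ℂ) (ψ : W →ₗ[ℂ] ((adelicGroupData F E c N J).Adelic → (Fin 2 → ℂ))) :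
    conjMap (r • ψ) = starRingEnd ℂ r • conjMap ψ := by
  refine LinearMap.ext fun w => ?_
  rw [conjMap_apply, LinearMap.smul_apply, LinearMap.map_smulₛₗ, LinearMap.smul_apply, conjMap_apply]

/-- Right translation commutes with componentwise conjugation: `\overline{R(g)Φ} = R(g) Φ̄` (definitional). [cite: BorelJacquet1979, §4.6] -/
theorem conjFun_rightRep (g : finAdelic F E c N J) (Φ : (adelicGroupData F E c N J).Adelic → (Fin 2 → ℂ)) :
    conjFun F E c N J (rightRep F E c N J g Φ) = rightRep F E c N J g (conjFun F E c N J Φ) := rfl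

/-- **`ψ̄` is `σ̄`-equivariant when `ψ` is `σ`-equivariant** (for the finite-adelic right translation). [cite: BorelJacquet1979, §4.6] -/
theorem conjMap_equivariant {σ : Representation ℂ (finAdelic F E c N J) W} {ψ : W →ₗ[ℂ] ((adelicGroupData F E c N J).Adelic → (Fin 2 → ℂ))}
    (hψ : ∀ (g : finAdelic F E c N J) (w : W), ψ (σ g w) = rightRep F E c N J g (ψ w)) (g : finAdelic F E c N J) (w : ConjVec W) :
    conjMap ψ (repConj σ g w) = rightRep F E c N J g (conjMap ψ w) := by
  rw [conjMap_apply, conjMap_apply, repConj_apply, LinearEquiv.symm_apply_apply, hψ, conjFun_rightRep]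

/-- **`ψ` is `σ`-equivariant when `ψ'` is `σ̄`-equivariant**, `ψ = unconjMap ψ'`. [cite: BorelJacquet1979, §4.6] -/
theorem unconjMap_equivariant {σ : Representation ℂ (finAdelic F E c N J) W} {ψ' : ConjVec W →ₗ[ℂ] ((adelicGroupData F E c N J).Adelic → (Fin 2 → ℂ))}
    (hψ' : ∀ (g : finAdelic F E c N J) (w : ConjVec W), ψ' (repConj σ g w) = rightRep F E c N J g (ψ' w)) (g : finAdelic F E c N J) (w : W) :
    unconjMap ψ' (σ g w) = rightRep F E c N J g (unconjMap ψ' w) := by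
  rw [unconjMap_apply, unconjMap_apply, ← repConj_apply_toConj, hψ', conjFun_rightRep]

variable {μ : Measure (adelicGroupData F E c N J).automorphicQuotient}
  [SMulInvariantMeasure (adelicGroupData F E c N J).Adelic (adelicGroupData F E c N J).automorphicQuotient μ]

/-- **`P̄` has finite component `σ̄` when `P` has finite component `σ`**: `f ↦ f̄ := conjEquiv ∘ f ∘ toConj⁻¹` (★ `ClosedSubrep.conjEquiv`, `f̄(w̄) = \overline{f(w)}`)
is an injective `σ̄ → P̄`-intertwiner. [cite: BorelJacquet1979, §4.6] [cite: Clozel1990, §3.1] -/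
theorem hasFinComponent_conj_repConj (P : DiscreteAutomorphicRep (adelicGroupData F E c N J) μ)
    {σ : Representation ℂ (finAdelic F E c N J) W} (h : P.HasFinComponent σ) : P.conj.HasFinComponent (repConj σ) := by
  obtain ⟨f, hf⟩ := h
  have hce : ∀ (g : (adelicGroupData F E c N J).Adelic) (v : P.space.toSubmodule),
      P.space.conjEquiv (P.space.toContRep g v) = P.space.conj.toContRep g (P.space.conjEquiv v) :=
    P.space.isSemilinearEquivariant_mapSemilinearEquiv (AdelicGroupData.isSemilinearEquivariant_conjL2 _ μ)
  let fbar : ConjVec W →ₗ[ℂ] P.conj.space.toSubmodule :=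
    ((P.space.conjEquiv : P.space.toSubmodule →SL[starRingEnd ℂ] P.space.conj.toSubmodule) :
        P.space.toSubmodule →ₛₗ[starRingEnd ℂ] P.space.conj.toSubmodule).comp
      (f.toLinearMap.comp ((toConj (V := W)).symm : ConjVec W →ₛₗ[starRingEnd ℂ] W))
  have hfbar : ∀ w : ConjVec W, fbar w = P.space.conjEquiv (f ((toConj (V := W)).symm w)) := fun _ => rfl
  refine ⟨LinearMap.intertwiningMap_of_isIntertwiningMap (repConj σ) P.conj.finRep fbar (fun g w => ?_), ?_⟩
  · rw [hfbar, hfbar, repConj_apply, LinearEquiv.symm_apply_apply,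
      Representation.IntertwiningMap.isIntertwining σ P.finRep f g]
    exact hce _ _
  · intro w w' hww'
    have h1 : fbar w = fbar w' := hww'
    rw [hfbar, hfbar] at h1
    exact (toConj (V := W)).symm.injective (hf (P.space.conjEquiv.injective h1))

end Maps

/-! ### The letters: (E1′) and (E), holomorphic ⟺ antiholomorphic -/

/-- **(E1′-hol) ⟹ (E1′-antihol): at most one ANTIholomorphic-type discrete `P` with a given finite component, from the holomorphic statement** applied to
the conjugates `P̄, P̄′` (holomorphic type, ★ `isAntiholCotangentAt_iff_conj`) and `σ̄` (`hasFinComponent_conj_repConj`), then `P ↦ P̄` is injective.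
[cite: BorelWallach2000, VII 2.10, 3.2] [cite: Clozel1990, §3.1] -/
theorem cohFinComponentUnique_antihol_of_hol (h : Rogawski1990.cohFinComponentUnique_hol) : Rogawski1990.cohFinComponentUnique_antihol := by
  intro L _ _ _ ι H T hT hpos h2 μ _ W _ _ σ hirr hsm P P' hP hP' hf hf'
  have key := h L ι H T hT hpos h2 μ (ConjVec W) (repConj σ) ((isIrreducible_repConj_iff σ).mpr hirr)
    ((isSmooth_repConj_iff σ).mpr hsm) P.conj P'.conj ((isAntiholCotangentAt_iff_conj P _ _).mp hP)
    ((isAntiholCotangentAt_iff_conj P' _ _).mp hP') (hasFinComponent_conj_repConj P hf) (hasFinComponent_conj_repConj P' hf')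
  rw [← P.conj_conj, key, P'.conj_conj]

/-- **(E1′-antihol) ⟹ (E1′-hol)**, by the same conjugation (`isHolCotangentAt_iff_conj`). [cite: BorelWallach2000, VII 2.10, 3.2] [cite: Clozel1990, §3.1] -/
theorem cohFinComponentUnique_hol_of_antihol (h : Rogawski1990.cohFinComponentUnique_antihol) : Rogawski1990.cohFinComponentUnique_hol := by
  intro L _ _ _ ι H T hT hpos h2 μ _ W _ _ σ hirr hsm P P' hP hP' hf hf'
  have key := h L ι H T hT hpos h2 μ (ConjVec W) (repConj σ) ((isIrreducible_repConj_iff σ).mpr hirr)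
    ((isSmooth_repConj_iff σ).mpr hsm) P.conj P'.conj ((isHolCotangentAt_iff_conj P _ _).mp hP)
    ((isHolCotangentAt_iff_conj P' _ _).mp hP') (hasFinComponent_conj_repConj P hf) (hasFinComponent_conj_repConj P' hf')
  rw [← P.conj_conj, key, P'.conj_conj]

/-- **(E1′-hol) ⟺ (E1′-antihol).** [cite: BorelWallach2000, VII 2.10, 3.2] [cite: Clozel1990, §3.1] -/
theorem cohFinComponentUnique_hol_iff_antihol : Rogawski1990.cohFinComponentUnique_hol ↔ Rogawski1990.cohFinComponentUnique_antihol :=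
  ⟨cohFinComponentUnique_antihol_of_hol, cohFinComponentUnique_hol_of_antihol⟩

/-- **(E-hol) ⟹ (E-antihol): the antiholomorphic cotangent isotypic line of `P` from the holomorphic line of `P̄`.**  For `ψ : σ → (antihol forms in P)`
equivariant, `ψ̄ = conjMap ψ : σ̄ → (hol forms in P̄)` is equivariant (`conjMap_equivariant`, ★ `containsForm_conjFun_iff`), so `ψ̄ = r • ψ̄₀` by (E-hol) at
`(σ̄, P̄)`, whence `ψ = r̄ • unconjMap ψ̄₀`. [cite: BorelWallach2000, VII 2.10, 3.2] [cite: Clozel1990, §3.1] -/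
theorem cohIsotypicLine_antihol_of_hol (h : cohIsotypicLine_hol) : cohIsotypicLine_antihol := by
  intro L _ _ _ ι H T hT hpos h2 μ _ W _ _ σ hirr hsm P
  obtain ⟨ψ₀', hψ₀'⟩ := h L ι H T hT hpos h2 μ (ConjVec W) (repConj σ) ((isIrreducible_repConj_iff σ).mpr hirr)
    ((isSmooth_repConj_iff σ).mpr hsm) P.conj
  refine ⟨unconjMap ψ₀', fun ψ hψσ hψval => ?_⟩
  obtain ⟨r, hr⟩ := hψ₀' (conjMap ψ) (conjMap_equivariant hψσ) (fun w => by
    obtain ⟨hmem, hcont⟩ := hψval ((toConj (V := W)).symm w)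
    obtain ⟨Φ₀, hΦ₀, hΦ₀eq⟩ := Submodule.mem_map.mp hmem
    refine ⟨?_, ?_⟩
    · rw [conjMap_apply, ← hΦ₀eq, conjFun_conjFun]
      exact hΦ₀
    · rw [conjMap_apply, containsForm_conjFun_iff, DiscreteAutomorphicRep.conj_conj]
      exact hcont)
  refine ⟨starRingEnd ℂ r, ?_⟩
  rw [← unconjMap_conjMap ψ, hr, unconjMap_smul]

/-- **(E-antihol) ⟹ (E-hol)**, by the same conjugation. [cite: BorelWallach2000, VII 2.10, 3.2] [cite: Clozel1990, §3.1] -/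
theorem cohIsotypicLine_hol_of_antihol (h : cohIsotypicLine_antihol) : cohIsotypicLine_hol := by
  intro L _ _ _ ι H T hT hpos h2 μ _ W _ _ σ hirr hsm P
  obtain ⟨ψ₀', hψ₀'⟩ := h L ι H T hT hpos h2 μ (ConjVec W) (repConj σ) ((isIrreducible_repConj_iff σ).mpr hirr)
    ((isSmooth_repConj_iff σ).mpr hsm) P.conj
  refine ⟨unconjMap ψ₀', fun ψ hψσ hψval => ?_⟩
  obtain ⟨r, hr⟩ := hψ₀' (conjMap ψ) (conjMap_equivariant hψσ) (fun w => by
    obtain ⟨hmem, hcont⟩ := hψval ((toConj (V := W)).symm w)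
    refine ⟨?_, ?_⟩
    · rw [conjMap_apply]
      exact Submodule.mem_map_of_mem hmem
    · rw [conjMap_apply, containsForm_conjFun_iff, DiscreteAutomorphicRep.conj_conj]
      exact hcont)
  refine ⟨starRingEnd ℂ r, ?_⟩
  rw [← unconjMap_conjMap ψ, hr, unconjMap_smul]

/-- **(E-hol) ⟺ (E-antihol).** [cite: BorelWallach2000, VII 2.10, 3.2] [cite: Clozel1990, §3.1] -/
theorem cohIsotypicLine_hol_iff_antihol : cohIsotypicLine_hol ↔ cohIsotypicLine_antihol :=
  ⟨cohIsotypicLine_antihol_of_hol, cohIsotypicLine_hol_of_antihol⟩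

end UnitaryGroup.CotangentForms

end Literature.NumberTheory.Automorphic

end
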